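import Literature.Computability.Cryptography.GoldreichLevinEnsembles
import Literature.Computability.Cryptography.LiuPassCondFromRegular
import Literature.Computability.Complexity.StackWordArith
import HarnessLib

/-!
# The Goldreich–Levin decoder on bit strings (the model the inverter's machine follows)

Crypto layer, part 2. Rackoff's candidate `glCandidate B k s τ` (`GoldreichLevin.lean`) is a
`Finset` expression over `𝔽₂`-vectors; the inverter of the Goldreich–Levin theorem is a machine
working on bit strings. This file fixes the **string model** of the decoder that the machine
(`FP` pipeline, sequel file) mirrors step by step, and proves it computes `glCandidate`:

* `vxor` (bitwise xor) and `encZ (u + w) = vxor (encZ u) (encZ w)`, the unit string `unitStr n i`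
  (`= encZ (e_i)`);
* `maskedXor n k mask S`: the xor of the `n`-bit blocks of `S` selected by the bits of `mask`, as
  `k` rounds of `mxStep` (consume one mask bit and one block) — `maskedXor_blocksStr`: on
  `S = blocksStr s` it is `encZ (Σ_{t ∈ maskSet mask} sᵗ)` (`seedSum`);
* the masks `pmask k p = fitLen (encodeNat p) k` of the numbers `p < 2^k` and the bijection
  `p ↦ maskSet (pmask k p)` from `[1, 2^k)` onto the nonempty subsets of `[k]`
  (`card_filter_Ico_eq`);
* the vote `vote n k B S τ i p` (`= glVote`, `bz_vote`), the count over `p ∈ [1, 2^k)`, the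
  majority bit and **`candStr_eq`**: `candStr n k B (blocksStr s) (encZ τ) = encZ (glCandidate B' k s τ)`
  for `B' r = bz (B (encZ r))`.

## References

* S. Arora, B. Barak, *Computational Complexity: A Modern Approach*, CUP 2009, Thm 9.12 (proof,
  Algorithm B′).
* O. Goldreich, *Foundations of Cryptography I*, CUP 2001, §2.5.2.
-/

namespace Literature.Computability.Cryptography

open Finset Matrix _root_.Computability Complexity Complexity.Stockmeyer AffineStr GLEns

namespace GLDec

variable {n k : ℕ}

/-! ### Bitwise xor and the encodings -/

/-- Bitwise xor of two bit strings (truncating to the shorter). [folklore] -/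
def vxor (a b : List Bool) : List Bool := List.zipWith Bool.xor a b

/-- `|vxor a b| = min |a| |b|`. [folklore] -/
@[simp] theorem length_vxor (a b : List Bool) : (vxor a b).length = min a.length b.length := by
  simp [vxor, List.length_zipWith]

/-- A bit of `𝔽₂`: `decide (a = 1)` and addition. [folklore] -/
theorem decide_add_eq_one (a b : ZMod 2) : decide (a + b = 1) = Bool.xor (decide (a = 1)) (decide (b = 1)) := by
  fin_cases a <;> fin_cases b <;> rfl

/-- **`encZ` is additive into `vxor`.** [folklore] -/
theorem encZ_add (u w : BVec n) : encZ n (u + w) = vxor (encZ n u) (encZ n w) := by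
  unfold encZ vxor
  apply List.ext_getElem
  · simp
  · intro i h1 h2
    simp [List.getElem_zipWith, decide_add_eq_one]

/-- `encZ 0 = 0ⁿ`. [folklore] -/
theorem encZ_zero : encZ n (0 : BVec n) = List.replicate n false := by
  unfold encZ
  apply List.ext_getElem
  · simp
  · intro i h1 h2; simp

/-- The unit string `e_i = 0^i 1 0^{n−i−1}`. [folklore] -/
def unitStr (n i : ℕ) : List Bool := List.replicate i false ++ [true] ++ List.replicate (n - i - 1) false

/-- `|unitStr n i| = n` for `i < n`. [folklore] -/
theorem length_unitStr {i : ℕ} (hi : i < n) : (unitStr n i).length = n := by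
  simp [unitStr]; omega

/-- **`encZ (e_i) = unitStr n i`.** [folklore] -/
theorem encZ_single (i : Fin n) : encZ n (Pi.single i 1) = unitStr n i := by
  unfold encZ
  apply List.ext_getElem
  · rw [List.length_ofFn, length_unitStr i.2]
  · intro j h1 h2
    rw [List.length_ofFn] at h1
    simp only [List.getElem_ofFn, unitStr, List.append_assoc]
    rcases lt_trichotomy j i with hj | hj | hj
    · rw [List.getElem_append_left (by simpa using hj), List.getElem_replicate,
        Pi.single_eq_of_ne (Fin.ne_of_lt (show (⟨j, h1⟩ : Fin n) < i from hj))]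
      decide
    · subst hj
      rw [List.getElem_append_right (by simp)]
      simp
    · rw [List.getElem_append_right (by simpa using hj.le)]
      simp only [List.length_replicate, List.singleton_append]
      rw [List.getElem_cons]
      simp only [show ¬ j - i = 0 by omega, dite_false, List.getElem_replicate]
      rw [Pi.single_eq_of_ne (Fin.ne_of_gt (show i < (⟨j, h1⟩ : Fin n) from hj))]
      decide

/-! ### The masked xor of blocks -/

/-- One round of the masked xor: consume one mask bit and one block, xor the block in if the bit
is set. State `(mask, blocks, acc)`. [folklore] -/
def mxStep (n : ℕ) (q : List Bool × List Bool × List Bool) : List Bool × List Bool × List Bool :=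
  (q.1.tail, q.2.1.drop n, if q.1.headD false then vxor q.2.2 (q.2.1.take n) else q.2.2)

/-- **The masked xor** `⊕_{t : mask_t = 1} S_t` of the `n`-bit blocks of `S`, `k` rounds of `mxStep`
from the accumulator `0ⁿ`. [Arora–Barak 2009, Thm 9.12 (proof: `r_T = Σ_{t∈T} sᵗ`)] [folklore] -/
def maskedXor (n k : ℕ) (mask S : List Bool) : List Bool := ((mxStep n)^[k] (mask, S, List.replicate n false)).2.2

/-- The subset of `[k]` selected by a mask. [folklore] -/
def maskSet (k : ℕ) (mask : List Bool) : Finset (Fin k) := univ.filter fun t => mask.getD t false = true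

/-- `getD 0` is `headD`. [folklore] -/
theorem getD_zero_eq_headD (l : List Bool) : l.getD 0 false = l.headD false := by
  cases l <;> simp

/-- A filtered sum over `Fin (k+1)` split at `0`. [folklore] -/
theorem sum_maskSet_succ {M : Type*} [AddCommMonoid M] (mask : List Bool) (f : Fin (k + 1) → M) :
    ∑ t ∈ maskSet (k + 1) mask, f t =
      (if mask.headD false then f 0 else 0) + ∑ t ∈ maskSet k mask.tail, f t.succ := by
  unfold maskSet
  rw [Finset.sum_filter, Finset.sum_filter, Fin.sum_univ_succ]
  congr 1
  · simp only [Fin.val_zero, getD_zero_eq_headD]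
  · refine Finset.sum_congr rfl fun t _ => ?_
    have htail : mask.tail.getD t false = mask.getD (t + 1) false := by cases mask <;> simp
    simp only [Fin.val_succ, ← htail]

/-- The loop invariant of the masked xor on block strings. [folklore] -/
theorem mxStep_iterate_blocksStr : ∀ {k : ℕ} (mask : List Bool) (sv : Fin k → BVec n) (a : BVec n),
    ((mxStep n)^[k] (mask, blocksStr sv, encZ n a)).2.2 = encZ n (a + ∑ t ∈ maskSet k mask, sv t)
  | 0, mask, sv, a => by simp [maskSet]
  | k + 1, mask, sv, a => by
    rw [Function.iterate_succ_apply, sum_maskSet_succ]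
    have hS : blocksStr sv = encZ n (sv 0) ++ blocksStr (fun t => sv t.succ) := by
      simp [blocksStr, List.ofFn_succ]
    have hstep : mxStep n (mask, blocksStr sv, encZ n a) =
        (mask.tail, blocksStr (fun t => sv t.succ), encZ n (a + if mask.headD false then sv 0 else 0)) := by
      simp only [mxStep, hS]
      rw [List.drop_append_of_le_length (by simp), List.drop_of_length_le (by simp), List.nil_append,
        List.take_append_of_le_length (by simp), List.take_of_length_le (by simp)]
      split_ifs with h
      · rw [encZ_add]
      · rw [add_zero]
    rw [hstep, mxStep_iterate_blocksStr mask.tail (fun t => sv t.succ)]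
    congr 1
    split_ifs <;> abel

/-- **The masked xor of block strings is the selected sum.** [folklore] -/
theorem maskedXor_blocksStr (mask : List Bool) (sv : Fin k → BVec n) :
    maskedXor n k mask (blocksStr sv) = encZ n (∑ t ∈ maskSet k mask, sv t) := by
  rw [maskedXor, ← encZ_zero, mxStep_iterate_blocksStr, zero_add]

/-! ### Parities of masked bits -/

/-- **The inner-product bit of a mask of length `k` with `encZ τ` is the selected parity.** [folklore] -/
theorem bz_ipBit_mask {mask : List Bool} (hm : mask.length = k) (τv : BVec k) :
    bz (ipBit mask (encZ k τv)) = ∑ t ∈ maskSet k mask, τv t := by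
  have h := bz_ipBit (⟨mask, hm⟩ : List.Vector Bool k) τv
  rw [List.Vector.toList_mk] at h
  rw [h, dotProduct, maskSet, Finset.sum_filter]
  refine Finset.sum_congr rfl fun t _ => ?_
  simp only [Stockmeyer.toZ]
  rw [get_eq_getD, List.Vector.toList_mk]
  cases mask.getD t false <;> simp [bz]

/-! ### The masks of the numbers `p < 2^k` and the nonempty subsets -/

/-- The `k`-bit mask of `p`: its little-endian binary digits, padded (`fitLen (encodeNat p) k`). [folklore] -/
def pmask (k p : ℕ) : List Bool := CondParams.fitLen (encodeNat p) k

/-- `|pmask k p| = k`. [folklore] -/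
@[simp] theorem length_pmask (k p : ℕ) : (pmask k p).length = k := CondParams.length_fitLen _ _

/-- **The bits of the mask are the binary digits**: `(pmask k p)_t = testBit p t` for `t < k`. [folklore] -/
theorem getD_pmask (p : ℕ) (t : Fin k) : (pmask k p).getD t false = p.testBit t := by
  unfold pmask CondParams.fitLen
  rw [List.getD_eq_getElem?_getD, List.getElem?_take, if_pos t.2, List.getElem?_append]
  split_ifs with h
  · rw [← List.getD_eq_getElem?_getD, ← Com.testBit_bitsToNat, bitsToNat_encodeNat]
  · push Not at h
    rw [List.getElem?_replicate]
    have ht : (bitsToNat (encodeNat p)).testBit t = false := by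
      rw [Com.testBit_bitsToNat, List.getD_eq_default _ _ h]
    rw [bitsToNat_encodeNat] at ht
    rw [ht]
    split_ifs <;> rfl

/-- The subset of `[k]` coded by `p`: `{t : testBit p t}`. [folklore] -/
def setOf (k p : ℕ) : Finset (Fin k) := maskSet k (pmask k p)

/-- Membership in `setOf`. [folklore] -/
@[simp] theorem mem_setOf {p : ℕ} {t : Fin k} : t ∈ setOf k p ↔ p.testBit t = true := by
  simp only [setOf, maskSet, Finset.mem_filter, Finset.mem_univ, true_and, getD_pmask]

/-- `setOf` is injective below `2^k`. [folklore] -/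
theorem setOf_injOn : Set.InjOn (setOf k) (Finset.range (2 ^ k) : Set ℕ) := by
  intro p hp q hq h
  rw [Finset.coe_range, Set.mem_Iio] at hp hq
  apply Nat.eq_of_testBit_eq
  intro t
  by_cases ht : t < k
  · have := Finset.ext_iff.1 h ⟨t, ht⟩
    simp only [mem_setOf] at this
    rcases Bool.eq_false_or_eq_true (p.testBit t) with h1 | h1 <;>
      rcases Bool.eq_false_or_eq_true (q.testBit t) with h2 | h2 <;> simp_all
  · push Not at ht
    have h2k : 2 ^ k ≤ 2 ^ t := Nat.pow_le_pow_right (by norm_num) ht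
    rw [Nat.testBit_eq_false_of_lt (lt_of_lt_of_le hp h2k), Nat.testBit_eq_false_of_lt (lt_of_lt_of_le hq h2k)]

/-- `setOf k 0 = ∅`. [folklore] -/
@[simp] theorem setOf_zero : setOf k 0 = ∅ := by
  ext t; simp

/-- Every subset is coded by some `p < 2^k`. [folklore] -/
theorem image_setOf_range : (Finset.range (2 ^ k)).image (setOf k) = univ := by
  apply Finset.eq_univ_of_card
  rw [Finset.card_image_of_injOn setOf_injOn, Finset.card_range, Fintype.card_finset, Fintype.card_fin]

/-- **`[1, 2^k)` codes exactly the nonempty subsets.** [folklore] -/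
theorem image_setOf_Ico : (Finset.Ico 1 (2 ^ k)).image (setOf k) = nonemptySubsets k := by
  ext T
  simp only [Finset.mem_image, Finset.mem_Ico, nonemptySubsets, Finset.mem_filter, Finset.mem_univ, true_and]
  constructor
  · rintro ⟨p, ⟨hp1, hp2⟩, rfl⟩
    rw [Finset.nonempty_iff_ne_empty]
    intro h0
    have : p = 0 := setOf_injOn (by simpa using hp2) (by simp) (h0.trans setOf_zero.symm)
    omega
  · intro hT
    have hmem : T ∈ (Finset.range (2 ^ k)).image (setOf k) := by rw [image_setOf_range]; exact Finset.mem_univ _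
    obtain ⟨p, hp, rfl⟩ := Finset.mem_image.1 hmem
    refine ⟨p, ⟨?_, by simpa using hp⟩, rfl⟩
    by_contra h0
    have : p = 0 := by omega
    subst this
    rw [setOf_zero] at hT
    exact Finset.not_nonempty_empty hT

/-- **Counting over `p ∈ [1, 2^k)` is counting over the nonempty subsets.** [folklore] -/
theorem card_filter_Ico_eq (P : Finset (Fin k) → Prop) [DecidablePred P] :
    ((Finset.Ico 1 (2 ^ k)).filter fun p => P (setOf k p)).card = ((nonemptySubsets k).filter P).card := by
  rw [← image_setOf_Ico, Finset.filter_image, Finset.card_image_of_injOn]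
  exact fun p hp q hq h => setOf_injOn (by have := (Finset.mem_filter.1 hp).1; simp at this ⊢; omega)
    (by have := (Finset.mem_filter.1 hq).1; simp at this ⊢; omega) h

/-! ### Votes and the candidate -/

section Cand

variable (B : List Bool → Bool) (n k)

/-- **The vote** of the subset coded by `p` for coordinate `i`: the parity of the guessed bits
selected by the mask, xor the predictor's answer on `r_T ⊕ e_i`. [Arora–Barak 2009, Thm 9.12
(proof, Algorithm B′)] [cite: AroraBarak2009, Thm. 9.12] -/
def vote (S τ : List Bool) (i p : ℕ) : Bool :=
  Bool.xor (ipBit (pmask k p) τ) (B (vxor (maskedXor n k (pmask k p) S) (unitStr n i)))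

/-- The number of subsets voting `1` for coordinate `i`. [cite: AroraBarak2009, Thm. 9.12] -/
def voteCount (S τ : List Bool) (i : ℕ) : ℕ := ((Finset.Ico 1 (2 ^ k)).filter fun p => vote n k B S τ i p = true).card

/-- **The majority bit** of coordinate `i`. [cite: AroraBarak2009, Thm. 9.12] -/
def candBit (S τ : List Bool) (i : ℕ) : Bool := decide (2 ^ k - 1 < 2 * voteCount n k B S τ i)

/-- **The candidate string** (Rackoff's candidate, bit by bit). [cite: AroraBarak2009, Thm. 9.12] -/
def candStr (S τ : List Bool) : List Bool := List.ofFn fun i : Fin n => candBit n k B S τ i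

variable {B n k}

/-- `bz` of a Boolean `xor`-free reading: `b = true ↔ bz b = 1`. [folklore] -/
theorem eq_true_iff_bz_eq_one (b : Bool) : b = true ↔ bz b = 1 := by cases b <;> decide

/-- **The string vote is `glVote`** for the predictor `B' r = bz (B (encZ r))`. [cite: AroraBarak2009, Thm. 9.12] -/
theorem bz_vote (sv : Fin k → BVec n) (τv : BVec k) (i : Fin n) (p : ℕ) :
    bz (vote n k B (blocksStr sv) (encZ k τv) i p) = glVote (fun r => bz (B (encZ n r))) sv τv (setOf k p) i := by
  rw [vote, bz_xor, bz_ipBit_mask (length_pmask k p), maskedXor_blocksStr, ← encZ_single, ← encZ_add]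
  rfl

/-- **The string decoder computes Rackoff's candidate**:
`candStr n k B (blocksStr s) (encZ τ) = encZ (glCandidate B' k s τ)`. [cite: AroraBarak2009, Thm. 9.12] -/
theorem candStr_eq (sv : Fin k → BVec n) (τv : BVec k) :
    candStr n k B (blocksStr sv) (encZ k τv) = encZ n (glCandidate (fun r => bz (B (encZ n r))) k sv τv) := by
  unfold candStr encZ
  congr 1
  funext i
  have hcount : voteCount n k B (blocksStr sv) (List.ofFn fun j : Fin k => decide (τv j = 1)) i =
      ((nonemptySubsets k).filter fun T => glVote (fun r => bz (B (List.ofFn fun j : Fin n => decide (r j = 1)))) sv τv T i = 1).card := by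
    unfold voteCount
    rw [← card_filter_Ico_eq]
    congr 1
    refine Finset.filter_congr fun p _ => ?_
    rw [eq_true_iff_bz_eq_one]
    exact Iff.of_eq (congrArg (· = 1) (bz_vote sv τv i p))
  rw [candBit, hcount, glCandidate, card_nonemptySubsets]
  split_ifs with h <;> simp [h]

end Cand

/-! ### Slicing block strings -/

/-- `take (j·n)` of a concatenation of `n`-blocks is the concatenation of the first `j` blocks. [folklore] -/
theorem take_flatten_blocks : ∀ (L : List (List Bool)) (j : ℕ), (∀ l ∈ L, l.length = n) →
    L.flatten.take (j * n) = (L.take j).flatten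
  | [], j, _ => by simp
  | l :: L, 0, _ => by simp
  | l :: L, j + 1, h => by
    have hl : l.length = n := h l (by simp)
    rw [List.flatten_cons, Nat.succ_mul, Nat.add_comm, List.take_append, List.take_of_length_le (by omega),
      hl, Nat.add_sub_cancel_left, List.take_succ_cons, List.flatten_cons,
      take_flatten_blocks L j fun l' hl' => h l' (by simp [hl'])]

/-- `drop (j·n)` of a concatenation of `n`-blocks drops the first `j` blocks. [folklore] -/
theorem drop_flatten_blocks : ∀ (L : List (List Bool)) (j : ℕ), (∀ l ∈ L, l.length = n) →
    L.flatten.drop (j * n) = (L.drop j).flatten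
  | [], j, _ => by simp
  | l :: L, 0, _ => by simp
  | l :: L, j + 1, h => by
    have hl : l.length = n := h l (by simp)
    rw [List.flatten_cons, Nat.succ_mul, Nat.add_comm, ← List.drop_drop, ← hl, List.drop_left, hl,
      List.drop_succ_cons, drop_flatten_blocks L j fun l' hl' => h l' (by simp [hl'])]

/-- The blocks before `j₀` do not see an update at `j₀`. [folklore] -/
theorem take_blocksStr_update {K : ℕ} (σ : Fin K → BVec n) (j₀ : Fin K) (w : BVec n) :
    (blocksStr (Function.update σ j₀ w)).take (j₀ * n) = (blocksStr σ).take (j₀ * n) := by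
  unfold blocksStr
  rw [take_flatten_blocks _ _ (by simp), take_flatten_blocks _ _ (by simp)]
  congr 1
  apply List.ext_getElem (by simp)
  intro t h1 h2
  rw [List.getElem_take, List.getElem_take, List.getElem_ofFn, List.getElem_ofFn, Function.update_of_ne]
  exact Fin.ne_of_lt (show t < (j₀ : ℕ) by simp at h1; omega)

/-- The blocks after `j₀` do not see an update at `j₀`. [folklore] -/
theorem drop_blocksStr_update {K : ℕ} (σ : Fin K → BVec n) (j₀ : Fin K) (w : BVec n) :
    (blocksStr (Function.update σ j₀ w)).drop ((j₀ + 1) * n) = (blocksStr σ).drop ((j₀ + 1) * n) := by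
  unfold blocksStr
  rw [drop_flatten_blocks _ _ (by simp), drop_flatten_blocks _ _ (by simp)]
  congr 1
  apply List.ext_getElem (by simp)
  intro t h1 h2
  rw [List.getElem_drop, List.getElem_drop, List.getElem_ofFn, List.getElem_ofFn, Function.update_of_ne]
  exact Fin.ne_of_gt (show (j₀ : ℕ) < (j₀ : ℕ) + 1 + t by omega)

/-- A block string is prefix ‖ block `j₀` ‖ suffix. [folklore] -/
theorem blocksStr_eq_take_append {K : ℕ} (σ : Fin K → BVec n) (j₀ : Fin K) :
    blocksStr σ = (blocksStr σ).take (j₀ * n) ++ encZ n (σ j₀) ++ (blocksStr σ).drop ((j₀ + 1) * n) := by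
  conv_lhs => rw [← List.take_append_drop (j₀ * n) (blocksStr σ)]
  rw [List.append_assoc]
  congr 1
  rw [← List.take_append_drop n ((blocksStr σ).drop (j₀ * n)), drop_take_blocksStr, List.drop_drop, Nat.succ_mul]

/-! ### The predictor on strings -/

/-- Position of the first `true` (the length if there is none). [folklore] -/
def firstTrue : List Bool → ℕ
  | [] => 0
  | b :: l => if b then 0 else firstTrue l + 1

/-- `firstTrue l ≤ |l|`. [folklore] -/
theorem firstTrue_le : ∀ l : List Bool, firstTrue l ≤ l.length
  | [] => le_rfl
  | b :: l => by unfold firstTrue; split_ifs <;> simp [firstTrue_le l]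

/-- Before the first `true` all bits are `false`. [folklore] -/
theorem getD_eq_false_of_lt_firstTrue : ∀ (l : List Bool) {t : ℕ}, t < firstTrue l → l.getD t false = false
  | [], t, h => by simp
  | b :: l, t, h => by
    unfold firstTrue at h
    split_ifs at h with hb
    · omega
    · cases t with
      | zero => simpa using hb
      | succ t => rw [List.getD_cons_succ]; exact getD_eq_false_of_lt_firstTrue l (by omega)

/-- At the first `true` (if inside) the bit is `true`. [folklore] -/
theorem getD_firstTrue : ∀ (l : List Bool), firstTrue l < l.length → l.getD (firstTrue l) false = true
  | [], h => by simp [firstTrue] at h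
  | b :: l, h => by
    unfold firstTrue at h ⊢
    split_ifs at h ⊢ with hb
    · simpa using hb
    · rw [List.getD_cons_succ]; exact getD_firstTrue l (by simpa using h)

/-- **`firstTrue` is the minimum of the mask's subset** (mask of length `K` with a set bit). [folklore] -/
theorem firstTrue_eq_min' {K : ℕ} {mask : List Bool} (hm : mask.length = K) (h : (maskSet K mask).Nonempty) :
    firstTrue mask < K ∧ ∀ hlt : firstTrue mask < K, (maskSet K mask).min' h = ⟨firstTrue mask, hlt⟩ := by
  have hlt : firstTrue mask < K := by
    by_contra hge
    push Not at hge
    obtain ⟨t, ht⟩ := h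
    have := (Finset.mem_filter.1 ht).2
    rw [getD_eq_false_of_lt_firstTrue mask (lt_of_lt_of_le t.2 hge)] at this
    exact Bool.false_ne_true this
  refine ⟨hlt, fun _ => ?_⟩
  apply le_antisymm
  · apply Finset.min'_le
    exact Finset.mem_filter.2 ⟨Finset.mem_univ _, getD_firstTrue mask (by rw [hm]; exact hlt)⟩
  · apply Finset.le_min'
    intro t ht
    have := (Finset.mem_filter.1 ht).2
    by_contra hlt'
    push Not at hlt'
    rw [getD_eq_false_of_lt_firstTrue mask (by exact hlt')] at this
    exact Bool.false_ne_true this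

/-- No set bit among the first `K` iff the subset is empty. [folklore] -/
theorem maskSet_eq_empty_iff {K : ℕ} {mask : List Bool} (hm : mask.length = K) :
    maskSet K mask = ∅ ↔ K ≤ firstTrue mask := by
  constructor
  · intro h0
    by_contra hlt
    push Not at hlt
    have : (⟨firstTrue mask, hlt⟩ : Fin K) ∈ maskSet K mask :=
      Finset.mem_filter.2 ⟨Finset.mem_univ _, getD_firstTrue mask (by rw [hm]; exact hlt)⟩
    rw [h0] at this
    exact Finset.notMem_empty _ this
  · intro hle
    ext t
    simp only [maskSet, Finset.mem_filter, Finset.mem_univ, true_and, Finset.notMem_empty, iff_false]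
    rw [getD_eq_false_of_lt_firstTrue mask (lt_of_lt_of_le t.2 hle)]
    exact Bool.false_ne_true

section Pred

variable (D : RandAlg (List Bool) Bool) (n K : ℕ) (sgn : Bool) (maskJ : List Bool) (β : Bool) (ω' v cD y : List Bool)

/-- **The embedded seed blocks on strings**: the blocks of `ω'` with block `j₀ = firstTrue maskJ`
replaced by `r ⊕ M ⊕ ω'_{j₀}`, `M` the masked xor of the blocks of `ω'` (`= blocksStr (embed J j₀ ω' r)`,
`σStr_eq`). [cite: Goldreich2001, Thm. 2.5.6 (proof, Section 2.5.3)] -/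
def σStr (r : List Bool) : List Bool :=
  ω'.take (firstTrue maskJ * n) ++
    vxor (vxor r (maskedXor n K maskJ ω')) ((ω'.drop (firstTrue maskJ * n)).take n) ++
      ω'.drop ((firstTrue maskJ + 1) * n)

/-- **The predictor on strings** (`= predB`, `bz_predStr`): the fallback coin if the mask selects
nothing; otherwise the complement of (parity of the selected `v`-bits) ⊕ (sign ⊕ `D`'s answer on
`⟨1ⁿ, y ‖ σ ‖ v⟩`). [cite: Goldreich2001, Thm. 2.5.6 (proof, Section 2.5.3)] -/
def predStr (r : List Bool) : Bool :=
  if K ≤ firstTrue maskJ then β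
  else !(Bool.xor (ipBit maskJ v)
    (Bool.xor sgn (D.run (boolPair (unaryEncodeNat n) (y ++ σStr n K maskJ ω' r ++ v)) cD)))

variable {D n K sgn maskJ β ω' v cD y}

/-- `a + a = 0` for vectors over `𝔽₂`. [folklore] -/
theorem add_self_bvec (a : BVec n) : a + a = 0 := by
  funext i; exact CharTwo.add_self_eq_zero _

/-- **The embedded blocks are `embed`.** [cite: Goldreich2001, Thm. 2.5.6 (proof, Section 2.5.3)] -/
theorem σStr_eq {ω'v : Fin K → BVec n} (hω : ω' = blocksStr ω'v) {J : Finset (Fin K)} (hJ : maskSet K maskJ = J)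
    {j₀ : Fin K} (hj : firstTrue maskJ = j₀) (hj₀ : j₀ ∈ J) (rv : BVec n) :
    σStr n K maskJ ω' (encZ n rv) = blocksStr (GLPred.embed J j₀ ω'v rv) := by
  have hblk : vxor (vxor (encZ n rv) (maskedXor n K maskJ (blocksStr ω'v))) (encZ n (ω'v j₀)) =
      encZ n (rv + ∑ j ∈ J.erase j₀, ω'v j) := by
    rw [maskedXor_blocksStr, hJ, ← encZ_add, ← encZ_add, ← Finset.add_sum_erase J _ hj₀]
    congr 1
    calc rv + (ω'v j₀ + ∑ x ∈ J.erase j₀, ω'v x) + ω'v j₀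
        = rv + ∑ x ∈ J.erase j₀, ω'v x + (ω'v j₀ + ω'v j₀) := by abel
      _ = rv + ∑ x ∈ J.erase j₀, ω'v x := by rw [add_self_bvec, add_zero]
  rw [GLPred.embed, blocksStr_eq_take_append _ j₀, take_blocksStr_update, drop_blocksStr_update, Function.update_self,
    σStr, hω, hj, drop_take_blocksStr, hblk]

/-- **The string predictor is `predB`** (for the sign-adjusted distinguisher
`Df σ u c = sgn ⊕ D(1ⁿ, y ‖ blocks σ ‖ bits u; c)`). [cite: Goldreich2001, Thm. 2.5.6 (proof, Section 2.5.3)] -/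
theorem bz_predStr {ω'v : Fin K → BVec n} (hω : ω' = blocksStr ω'v) (hm : maskJ.length = K)
    {vv : BVec K} (hv : v = encZ K vv) {κ : ℕ} (c : List.Vector Bool κ) (hc : cD = c.toList) (rv : BVec n) :
    bz (predStr D n K sgn maskJ β ω' v cD y (encZ n rv)) =
      GLPred.predB (fun σ u (c : List.Vector Bool κ) =>
          Bool.xor sgn (D.run (boolPair (unaryEncodeNat n) (y ++ blocksStr σ ++ encZ K u)) c.toList))
        (maskSet K maskJ, bz β, ω'v, vv, c) rv := by
  subst hv hc hω
  unfold predStr GLPred.predB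
  by_cases hK : K ≤ firstTrue maskJ
  · have h0 : maskSet K maskJ = ∅ := (maskSet_eq_empty_iff hm).2 hK
    rw [if_pos hK]
    simp only [h0, Finset.not_nonempty_empty, dif_neg, not_false_eq_true]
  · rw [if_neg hK]
    have hne : (maskSet K maskJ).Nonempty := by
      rw [Finset.nonempty_iff_ne_empty, Ne, maskSet_eq_empty_iff hm]; exact hK
    simp only [hne, dif_pos]
    obtain ⟨hlt, hmin⟩ := firstTrue_eq_min' hm hne
    rw [σStr_eq rfl rfl (j₀ := ⟨firstTrue maskJ, hlt⟩) rfl (by rw [← hmin hlt]; exact Finset.min'_mem _ _), hmin hlt,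
      GLPred.parityPred, ← bz_ipBit_mask hm vv]
    generalize ipBit maskJ (encZ K vv) = a
    generalize D.run (boolPair (unaryEncodeNat n)
      (y ++ blocksStr (GLPred.embed (maskSet K maskJ) ⟨firstTrue maskJ, hlt⟩ ω'v rv) ++ encZ K vv)) c.toList = b
    cases a <;> cases sgn <;> cases b <;> decide

end Pred

end GLDec

end Literature.Computability.Cryptography
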